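import Literature.Combinatorics.Additive.BalogSzemerediGowersProofs
import Mathlib.Algebra.Group.TypeTags.Basic
import Mathlib.Data.Finset.Preimage
import Mathlib.Tactic

/-!
# Balog–Szemerédi–Gowers, multiplicative form for subsets of a field

Topic `Literature/Combinatorics/Additive`. Fully proved transfer of the tree's additive
single-subset energy form of BSG (`Zhao2023_thm7136`, Y. Zhao, *Graph Theory and Additive
Combinatorics*, Thm 7.13.6 — PROVED in `BalogSzemerediGowersProofs`) to the multiplicative group
of a field: for `0 ∉ A ⊂ 𝔽` with multiplicative energy `E×(A) ≥ |A|³/K` there is `A' ⊆ A` with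
`|A| ≤ C K^C |A'|` and `|A'A'| ≤ C K^C |A'|` (`Zhao2023_thm7136_mul`). The transfer goes through
`Additive 𝔽ˣ` and the injection `Additive 𝔽ˣ → 𝔽`.

Consumer: the spread-set energy bound of the DLOG band (crux `DlogGraphFlat`, `Summits/QuantumAdvantage`).
-/

namespace Literature.Combinatorics.Additive

open Finset
open scoped Pointwise Combinatorics.Additive

section Transfer

variable {F : Type*} [Field F] [DecidableEq F]

omit [DecidableEq F] in
/-- The embedding `Additive 𝔽ˣ → 𝔽` is injective. [folklore] -/
theorem val_toMul_injective :
    Function.Injective fun x : Additive Fˣ => ((Additive.toMul x : Fˣ) : F) := by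
  intro x y h
  exact Additive.toMul.injective (Units.ext h)

/-- The pullback of a zero-free `A ⊂ 𝔽` to `Additive 𝔽ˣ` maps back onto `A`. [folklore] -/
theorem image_val_preimage_units (A : Finset F) (hA0 : (0 : F) ∉ A) :
    (A.preimage (fun x : Additive Fˣ => ((Additive.toMul x : Fˣ) : F))
        (val_toMul_injective.injOn)).image (fun x : Additive Fˣ => ((Additive.toMul x : Fˣ) : F)) = A := by
  ext a
  simp only [Finset.mem_image, Finset.mem_preimage]
  constructor
  · rintro ⟨x, hx, rfl⟩; exact hx
  · intro ha
    have ha0 : a ≠ 0 := fun e => hA0 (e ▸ ha)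
    exact ⟨Additive.ofMul (Units.mk0 a ha0), by simpa using ha, by simp⟩

/-- Product sets come from sumsets in `Additive 𝔽ˣ`. [folklore] -/
theorem image_val_add_eq_mul (S T : Finset (Additive Fˣ)) :
    (S + T).image (fun x : Additive Fˣ => ((Additive.toMul x : Fˣ) : F)) =
      S.image (fun x : Additive Fˣ => ((Additive.toMul x : Fˣ) : F)) *
        T.image (fun x : Additive Fˣ => ((Additive.toMul x : Fˣ) : F)) := by
  ext a
  simp only [Finset.mem_image, Finset.mem_add, Finset.mem_mul]
  constructor
  · rintro ⟨z, ⟨x, hx, y, hy, rfl⟩, rfl⟩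
    exact ⟨_, ⟨x, hx, rfl⟩, _, ⟨y, hy, rfl⟩, by simp [toMul_add]⟩
  · rintro ⟨_, ⟨x, hx, rfl⟩, _, ⟨y, hy, rfl⟩, rfl⟩
    exact ⟨x + y, ⟨x, hx, y, hy, rfl⟩, by simp [toMul_add]⟩

/-- Multiplicative energy of a zero-free `A ⊂ 𝔽` equals the additive energy of its pullback to
`Additive 𝔽ˣ`. [folklore] -/
theorem addEnergy_preimage_units (A : Finset F) (hA0 : (0 : F) ∉ A) :
    Finset.addEnergy
        (A.preimage (fun x : Additive Fˣ => ((Additive.toMul x : Fˣ) : F)) (val_toMul_injective.injOn))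
        (A.preimage (fun x : Additive Fˣ => ((Additive.toMul x : Fˣ) : F)) (val_toMul_injective.injOn)) =
      Finset.mulEnergy A A := by
  set φ : Additive Fˣ → F := fun x => ((Additive.toMul x : Fˣ) : F) with hφ
  set Au := A.preimage φ (val_toMul_injective.injOn) with hAu
  unfold Finset.addEnergy Finset.mulEnergy
  -- an inverse on F (total): a ↦ mk0 a, junk at 0
  set ψ : F → Additive Fˣ := fun a => if h : a = 0 then 0 else Additive.ofMul (Units.mk0 a h) with hψ
  have hφψ : ∀ a : F, a ≠ 0 → φ (ψ a) = a := by
    intro a ha; simp [hψ, hφ, ha]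
  have hψφ : ∀ x : Additive Fˣ, ψ (φ x) = x := by
    intro x
    have hx : φ x ≠ 0 := (Additive.toMul x).ne_zero
    apply val_toMul_injective
    exact hφψ _ hx
  have hmemA : ∀ x : Additive Fˣ, x ∈ Au ↔ φ x ∈ A := fun x => by rw [hAu, Finset.mem_preimage]
  refine Finset.card_bij'
    (fun x _ => (((φ x.1.1, φ x.1.2) : F × F), ((φ x.2.1, φ x.2.2) : F × F)))
    (fun y _ => (((ψ y.1.1, ψ y.1.2) : Additive Fˣ × Additive Fˣ),
      ((ψ y.2.1, ψ y.2.2) : Additive Fˣ × Additive Fˣ))) ?_ ?_ ?_ ?_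
  · intro x hx
    simp only [Finset.mem_filter, Finset.mem_product] at hx ⊢
    refine ⟨⟨⟨(hmemA _).mp hx.1.1.1, (hmemA _).mp hx.1.1.2⟩, (hmemA _).mp hx.1.2.1, (hmemA _).mp hx.1.2.2⟩, ?_⟩
    have e := congrArg φ hx.2
    simpa [hφ, toMul_add] using e
  · intro y hy
    simp only [Finset.mem_filter, Finset.mem_product] at hy ⊢
    obtain ⟨⟨⟨h11, h12⟩, h21, h22⟩, heq⟩ := hy
    have n11 : y.1.1 ≠ 0 := fun e => hA0 (e ▸ h11)
    have n12 : y.1.2 ≠ 0 := fun e => hA0 (e ▸ h12)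
    have n21 : y.2.1 ≠ 0 := fun e => hA0 (e ▸ h21)
    have n22 : y.2.2 ≠ 0 := fun e => hA0 (e ▸ h22)
    refine ⟨⟨⟨(hmemA _).mpr (by rw [hφψ _ n11]; exact h11), (hmemA _).mpr (by rw [hφψ _ n12]; exact h12)⟩,
      (hmemA _).mpr (by rw [hφψ _ n21]; exact h21), (hmemA _).mpr (by rw [hφψ _ n22]; exact h22)⟩, ?_⟩
    apply val_toMul_injective
    show φ (ψ y.1.1 + ψ y.2.1) = φ (ψ y.1.2 + ψ y.2.2)
    have hom : ∀ s t : Additive Fˣ, φ (s + t) = φ s * φ t := by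
      intro s t; simp [hφ, toMul_add]
    rw [hom, hom, hφψ _ n11, hφψ _ n12, hφψ _ n21, hφψ _ n22, heq]
  · intro x _
    simp only [hψφ]
  · intro y hy
    simp only [Finset.mem_filter, Finset.mem_product] at hy
    obtain ⟨⟨⟨h11, h12⟩, h21, h22⟩, _⟩ := hy
    have n11 : y.1.1 ≠ 0 := fun e => hA0 (e ▸ h11)
    have n12 : y.1.2 ≠ 0 := fun e => hA0 (e ▸ h12)
    have n21 : y.2.1 ≠ 0 := fun e => hA0 (e ▸ h21)
    have n22 : y.2.2 ≠ 0 := fun e => hA0 (e ▸ h22)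
    simp only [hφψ _ n11, hφψ _ n12, hφψ _ n21, hφψ _ n22]

end Transfer

/-- **BSG, multiplicative single-subset energy form in a field**: there is an absolute `C > 0`
such that for every field `𝔽`, every finite `A ⊂ 𝔽 ∖ {0}` and `K ≥ 1` with
`E×(A) ≥ |A|³ / K` there is `A' ⊆ A` with `|A| ≤ C K^C |A'|` and `|A'A'| ≤ C K^C |A'|`.
[cite: Zhao2023, Theorem 7.13.6 (applied in the group `𝔽ˣ`)] -/
theorem Zhao2023_thm7136_mul :
    ∃ C : ℝ, 0 < C ∧ ∀ (F : Type) [Field F] [DecidableEq F] (A : Finset F) (K : ℝ),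
      (0 : F) ∉ A → A.Nonempty → 1 ≤ K → (A.card : ℝ) ^ 3 / K ≤ Finset.mulEnergy A A →
      ∃ A' ⊆ A, (A.card : ℝ) ≤ C * K ^ C * A'.card ∧ ((A' * A').card : ℝ) ≤ C * K ^ C * A'.card := by
  obtain ⟨C, hC, h⟩ := Zhao2023_thm7136_holds
  refine ⟨C, hC, ?_⟩
  intro F _ _ A K hA0 hAne hK hE
  set φ : Additive Fˣ → F := fun x => ((Additive.toMul x : Fˣ) : F) with hφ
  have hinj : Function.Injective φ := val_toMul_injective
  set Au := A.preimage φ (hinj.injOn) with hAu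
  have himg : Au.image φ = A := image_val_preimage_units A hA0
  have hcard : Au.card = A.card := by
    rw [← himg, Finset.card_image_of_injective _ hinj]
  have hAune : Au.Nonempty := by
    rw [← Finset.card_pos, hcard, Finset.card_pos]; exact hAne
  have hEu : (Au.card : ℝ) ^ 3 / K ≤ Finset.addEnergy Au Au := by
    rw [hAu, addEnergy_preimage_units A hA0, ← hAu, hcard]; exact hE
  obtain ⟨A'u, hsub, h1, h2⟩ := h (Additive Fˣ) Au K hAune hK hEu
  refine ⟨A'u.image φ, ?_, ?_, ?_⟩
  · rw [← himg]; exact Finset.image_subset_image hsub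
  · rw [Finset.card_image_of_injective _ hinj, ← hcard]; exact h1
  · rw [← image_val_add_eq_mul, Finset.card_image_of_injective _ hinj,
      Finset.card_image_of_injective _ hinj]
    exact h2

end Literature.Combinatorics.Additive
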